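import Mathlib.Tactic
import Summits.CriticalPhenomena.PercolationContinuityZ3.Theorems.PercNearOneGluingNoHeavyLowerTailMultiTypeLSM
import HarnessLib

/-!
# THEOREM MT in closed form: the site sums as sums over copy states with binomial coefficients

Support file for the Sahi / Conjecture-P programme of route `PercNearOneGluingNoHeavy`
(`--supports stmt-CriticalPhenomena-4575`, prover prim-l12-p5 gen 31; proof notes
`prim-l12-p5/MULTITYPE-PROOF-g30.md` Lemma 2.1 and `prim-l12-p5/MULTITYPE-PROOF-g31.md`).
No definitions, no named facts, no sorries.

`…LowerTailMultiTypeLSM.multiType_lsm` states THEOREM MT (LSM-Z-2D for every multi-type de Finetti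
law with integer rates) with `A_m(x,y)` written as a sum over the configurations of the `T` copies
AND the `m` neutral sites.  Here the neutral sites are summed out: the number of ways to place
`x'` states `X` and `y'` states `Y` on `m` neutral sites is `C(m, y')·C(m − y', x')`
(`completions_count`), so that

  `A_m(x,y) = Σ_{s : Fin T → {0,X,Y}} w(s) · [i(s) ≤ x, l(s) ≤ y] · C(m, y − l(s)) · C(m − (y − l(s)), x − i(s))`

(`closed_form`; `i(s), l(s)` = numbers of copies in state `X`, `Y`; `w(s) = ∏ p_τ^{[s τ = X]} q_τ^{[s τ = Y]}`),
which is `(x! y!/m!)·` the state sum `G` of MULTITYPE-PROOF-g30 (1.1) when `m = x + y − 1`.  THEOREM MT in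
this form is `multiType_lsm_closedForm`.

* `card_split` : counting states on `Fin T ⊕ Fin m`;
* `completions_count` : `#{g : Fin m → {0,X,Y} : #X = x', #Y = y'} = C(m,y') C(m−y',x')`;
* `closed_form`, `multiType_lsm_closedForm`.
-/

namespace Summit.CriticalPhenomena.PercolationContinuityZ3.Theorems

namespace MultiTypeLSMClosedForm

open Finset

variable {T : ℕ}

/-- Counting states on `Fin T ⊕ Fin m` = on the copies + on the neutral sites. -/
theorem card_split (m : ℕ) (s : Fin T → Fin 3) (g : Fin m → Fin 3) (v : Fin 3) :
    (univ.filter (fun t : Fin T ⊕ Fin m => Sum.elim s g t = v)).card =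
      (univ.filter (fun τ => s τ = v)).card + (univ.filter (fun i => g i = v)).card := by
  rw [Finset.card_filter, Finset.card_filter, Finset.card_filter, Fintype.sum_sum_type]
  simp only [Sum.elim_inl, Sum.elim_inr]
  congr 1

/-- **Counting the completions on the neutral sites**: the number of `g : Fin m → {0,1,2}` with
`#g⁻¹(1) = x'` and `#g⁻¹(2) = y'` is `C(m, y')·C(m − y', x')` (as a real number, via the level
family of `…SiteCovariancePrelims` with all weights `1`). -/
theorem completions_count (m x' y' : ℕ) :
    ((((univ : Finset (Fin m → Fin 3)).filter (fun g : Fin m → Fin 3 =>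
        (univ.filter (fun i => g i = 1)).card = x' ∧ (univ.filter (fun i => g i = 2)).card = y')).card : ℕ) : ℝ) =
      ((m.choose y') * ((m - y').choose x') : ℝ) := by
  rw [Finset.card_eq_sum_ones, Nat.cast_sum, Nat.cast_one]
  -- weights all equal to 1
  have hw : ∀ g : Fin m → Fin 3,
      (∏ i, (if g i = 1 then (fun _ => (1:ℝ)) i else if g i = 2 then (fun _ => (1:ℝ)) i else 1)) = 1 :=
    fun g => Finset.prod_eq_one fun i _ => by split_ifs <;> rfl
  have h1 : ∑ _g ∈ univ.filter (fun g : Fin m → Fin 3 =>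
        (univ.filter (fun i => g i = 1)).card = x' ∧ (univ.filter (fun i => g i = 2)).card = y'), (1:ℝ) =
      ∑ Y₀ : Finset (Fin m), ∑ g ∈ univ.filter (fun g : Fin m → Fin 3 =>
        univ.filter (fun i => g i = 2) = Y₀ ∧ (univ.filter (fun i => g i = 1)).card = x' ∧
          (univ.filter (fun i => g i = 2)).card = y'),
        (∏ i, (if g i = 1 then (fun _ => (1:ℝ)) i else if g i = 2 then (fun _ => (1:ℝ)) i else 1)) := by
    rw [SiteCovariance.regroup]
    simp only [Finset.mem_univ, and_true, hw]
  rw [h1]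
  simp_rw [SiteCovariance.level_eq]
  have h2 : ∀ Y₀ : Finset (Fin m), ((univ \ Y₀).val.map (fun _ => (1:ℝ))).esymm x' =
      (((m - Y₀.card).choose x' : ℕ) : ℝ) := by
    intro Y₀
    rw [Finset.esymm_map_val]
    simp only [Finset.prod_const_one, Finset.sum_const, nsmul_eq_mul, mul_one, Finset.card_powersetCard,
      Finset.card_sdiff_of_subset (Finset.subset_univ Y₀), Finset.card_univ, Fintype.card_fin]
  simp_rw [h2, Finset.prod_const_one, mul_one]
  rw [show ∑ Y₀ : Finset (Fin m), (if Y₀.card = y' then (1:ℝ) else 0) * (((m - Y₀.card).choose x' : ℕ) : ℝ) =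
      ∑ Y₀ : Finset (Fin m), (if Y₀.card = y' then (((m - y').choose x' : ℕ) : ℝ) else 0) from
    Finset.sum_congr rfl fun Y₀ _ => by split_ifs with h <;> simp [h]]
  rw [← Finset.sum_filter, Finset.sum_const, nsmul_eq_mul, Finset.univ_filter_card_eq,
    Finset.card_powersetCard, Finset.card_univ, Fintype.card_fin]

/-- **Closed form of the site sums**: summing out the neutral sites,
`A_m(x,y) = Σ_s w(s)·[i(s) ≤ x][l(s) ≤ y]·C(m, y−l(s))·C(m−(y−l(s)), x−i(s))`. -/
theorem closed_form (p q : Fin T → ℝ) (m x y : ℕ) :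
    ∑ κ ∈ univ.filter (fun κ : Fin T ⊕ Fin m → Fin 3 =>
        (univ.filter (fun s => κ s = 1)).card = x ∧ (univ.filter (fun s => κ s = 2)).card = y),
        (∏ s, (if κ s = 1 then Sum.elim p (fun _ => (1:ℝ)) s else if κ s = 2 then Sum.elim q (fun _ => (1:ℝ)) s
          else 1)) =
      ∑ s : Fin T → Fin 3, (∏ τ, (if s τ = 1 then p τ else if s τ = 2 then q τ else 1)) *
        (if (univ.filter (fun τ => s τ = 1)).card ≤ x ∧ (univ.filter (fun τ => s τ = 2)).card ≤ y then
          (((m.choose (y - (univ.filter (fun τ => s τ = 2)).card)) *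
            ((m - (y - (univ.filter (fun τ => s τ = 2)).card)).choose
              (x - (univ.filter (fun τ => s τ = 1)).card)) : ℕ) : ℝ)
        else 0) := by
  rw [Finset.sum_filter,
    ← (Equiv.sumArrowEquivProdArrow (Fin T) (Fin m) (Fin 3)).symm.sum_comp, Fintype.sum_prod_type]
  refine Finset.sum_congr rfl fun s _ => ?_
  -- the inner sum over the neutral completions
  have hin : ∀ g : Fin m → Fin 3,
      (if (univ.filter (fun t => (Equiv.sumArrowEquivProdArrow (Fin T) (Fin m) (Fin 3)).symm (s, g) t = 1)).card = x ∧
          (univ.filter (fun t => (Equiv.sumArrowEquivProdArrow (Fin T) (Fin m) (Fin 3)).symm (s, g) t = 2)).card = y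
        then (∏ t, (if (Equiv.sumArrowEquivProdArrow (Fin T) (Fin m) (Fin 3)).symm (s, g) t = 1 then
          Sum.elim p (fun _ => (1:ℝ)) t else
          if (Equiv.sumArrowEquivProdArrow (Fin T) (Fin m) (Fin 3)).symm (s, g) t = 2 then
            Sum.elim q (fun _ => (1:ℝ)) t else 1))
        else 0) =
      (∏ τ, (if s τ = 1 then p τ else if s τ = 2 then q τ else 1)) *
        (if (univ.filter (fun τ => s τ = 1)).card ≤ x ∧ (univ.filter (fun τ => s τ = 2)).card ≤ y then
          (if (univ.filter (fun i => g i = 1)).card = x - (univ.filter (fun τ => s τ = 1)).card ∧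
              (univ.filter (fun i => g i = 2)).card = y - (univ.filter (fun τ => s τ = 2)).card then 1 else 0)
        else 0) := by
    intro g
    have he : ((Equiv.sumArrowEquivProdArrow (Fin T) (Fin m) (Fin 3)).symm (s, g)) = Sum.elim s g := by
      funext t; rcases t with τ | i <;> simp
    rw [he, card_split, card_split, MultiTypeLSM.weight_copies]
    simp only [Sum.elim_inl]
    by_cases hle : (univ.filter (fun τ => s τ = 1)).card ≤ x ∧ (univ.filter (fun τ => s τ = 2)).card ≤ y
    · rw [if_pos hle]
      by_cases hg : (univ.filter (fun i => g i = 1)).card = x - (univ.filter (fun τ => s τ = 1)).card ∧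
          (univ.filter (fun i => g i = 2)).card = y - (univ.filter (fun τ => s τ = 2)).card
      · rw [if_pos hg, if_pos (by omega), mul_one]
        exact Finset.prod_congr rfl fun τ _ => by split_ifs <;> rfl
      · rw [if_neg hg, if_neg (by omega), mul_zero]
    · rw [if_neg hle, if_neg (by omega), mul_zero]
  simp_rw [hin]
  rw [← Finset.mul_sum]
  congr 1
  split_ifs with hle
  · rw [Finset.sum_boole, completions_count]
    exact (Nat.cast_mul _ _).symm
  · simp

/-- **THEOREM MT in closed form.**  For `T` copies with `0 ≤ p_τ ≤ 1`, `0 ≤ q_τ` let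
`F_m(x,y) := Σ_{s : Fin T → {0,1,2}} (∏_τ p_τ^{[s τ=1]} q_τ^{[s τ=2]}) · [i(s) ≤ x, l(s) ≤ y] ·
C(m, y − l(s)) · C(m − (y − l(s)), x − i(s))` (`i, l` = numbers of copies in states `1 = X`, `2 = Y`).
Then for all `a, c, n`:  `F_{n+1}(a+1,c)·F_{n+1}(a,c+1) ≤ F_{n+2}(a+1,c+1)·F_n(a,c)`.
With `n + 1 = a + c`, `Zc(x,y) = x!·y!·F_{x+y−1}(x,y)` is the two-block cycle partition function of the
multi-type de Finetti law and this is LSM-Z-2D: `Zc(a+1,c) Zc(a,c+1) ≤ Zc(a+1,c+1) Zc(a,c)`. -/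
theorem multiType_lsm_closedForm (p q : Fin T → ℝ) (hp0 : ∀ τ, 0 ≤ p τ) (hp1 : ∀ τ, p τ ≤ 1)
    (hq : ∀ τ, 0 ≤ q τ) (a c n : ℕ) :
    (∑ s : Fin T → Fin 3, (∏ τ, (if s τ = 1 then p τ else if s τ = 2 then q τ else 1)) *
        (if (univ.filter (fun τ => s τ = 1)).card ≤ a + 1 ∧ (univ.filter (fun τ => s τ = 2)).card ≤ c then
          ((((n + 1).choose (c - (univ.filter (fun τ => s τ = 2)).card)) *
            ((n + 1 - (c - (univ.filter (fun τ => s τ = 2)).card)).choose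
              (a + 1 - (univ.filter (fun τ => s τ = 1)).card)) : ℕ) : ℝ)
        else 0)) *
      (∑ s : Fin T → Fin 3, (∏ τ, (if s τ = 1 then p τ else if s τ = 2 then q τ else 1)) *
        (if (univ.filter (fun τ => s τ = 1)).card ≤ a ∧ (univ.filter (fun τ => s τ = 2)).card ≤ c + 1 then
          ((((n + 1).choose (c + 1 - (univ.filter (fun τ => s τ = 2)).card)) *
            ((n + 1 - (c + 1 - (univ.filter (fun τ => s τ = 2)).card)).choose
              (a - (univ.filter (fun τ => s τ = 1)).card)) : ℕ) : ℝ)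
        else 0)) ≤
    (∑ s : Fin T → Fin 3, (∏ τ, (if s τ = 1 then p τ else if s τ = 2 then q τ else 1)) *
        (if (univ.filter (fun τ => s τ = 1)).card ≤ a + 1 ∧ (univ.filter (fun τ => s τ = 2)).card ≤ c + 1 then
          ((((n + 2).choose (c + 1 - (univ.filter (fun τ => s τ = 2)).card)) *
            ((n + 2 - (c + 1 - (univ.filter (fun τ => s τ = 2)).card)).choose
              (a + 1 - (univ.filter (fun τ => s τ = 1)).card)) : ℕ) : ℝ)
        else 0)) *
      (∑ s : Fin T → Fin 3, (∏ τ, (if s τ = 1 then p τ else if s τ = 2 then q τ else 1)) *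
        (if (univ.filter (fun τ => s τ = 1)).card ≤ a ∧ (univ.filter (fun τ => s τ = 2)).card ≤ c then
          (((n.choose (c - (univ.filter (fun τ => s τ = 2)).card)) *
            ((n - (c - (univ.filter (fun τ => s τ = 2)).card)).choose
              (a - (univ.filter (fun τ => s τ = 1)).card)) : ℕ) : ℝ)
        else 0)) := by
  have h := MultiTypeLSM.multiType_lsm p q hp0 hp1 hq a c n
  rw [closed_form, closed_form, closed_form, closed_form] at h
  exact h

/-- The binomial count of the closed form versus the falling-factorial weight of the lists model
(MULTITYPE-PROOF-g30 (1.1) / Lemma 2.1): for `m + 1 = x + y`,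
`[i ≤ x][l ≤ y]·C(m, y−l)·C(m−(y−l), x−i) = (m!/(x! y!)) · [i+l ≥ 1]·(x)_i (y)_l/(i+l−1)!`. -/
theorem choose_term_eq (m x y i l : ℕ) (hm : m + 1 = x + y) :
    (if i ≤ x ∧ l ≤ y then (((m.choose (y - l)) * ((m - (y - l)).choose (x - i)) : ℕ) : ℝ) else 0) =
      ((m.factorial : ℝ) / ((x.factorial : ℝ) * (y.factorial : ℝ))) *
        (if 1 ≤ i + l then ((x.descFactorial i * y.descFactorial l : ℕ) : ℝ) / (((i + l - 1).factorial : ℕ) : ℝ)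
          else 0) := by
  have hxf : (0:ℝ) < x.factorial := by exact_mod_cast x.factorial_pos
  have hyf : (0:ℝ) < y.factorial := by exact_mod_cast y.factorial_pos
  by_cases hle : i ≤ x ∧ l ≤ y
  swap
  · -- a falling factorial vanishes
    rw [if_neg hle]
    rcases not_and_or.1 hle with h | h
    · rw [Nat.descFactorial_eq_zero_iff_lt.2 (lt_of_not_ge h)]; simp
    · rw [Nat.descFactorial_eq_zero_iff_lt.2 (lt_of_not_ge h)]; simp
  rw [if_pos hle]
  obtain ⟨hi, hl⟩ := hle
  by_cases h0 : 1 ≤ i + l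
  swap
  · -- i = l = 0: one binomial coefficient vanishes
    rw [if_neg h0, mul_zero]
    have hi0 : i = 0 := by omega
    have hl0 : l = 0 := by omega
    subst hi0; subst hl0
    simp only [Nat.sub_zero]
    rcases Nat.eq_zero_or_pos x with hx | hx
    · subst hx
      have : m.choose y = 0 := Nat.choose_eq_zero_of_lt (by omega)
      simp [this]
    · have : (m - y).choose x = 0 := Nat.choose_eq_zero_of_lt (by omega)
      simp [this]
  rw [if_pos h0]
  -- factorial identities in ℕ
  have e1 : m.choose (y - l) * (y - l).factorial * (m - (y - l)).factorial = m.factorial :=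
    Nat.choose_mul_factorial_mul_factorial (by omega)
  have e2 : (m - (y - l)).choose (x - i) * (x - i).factorial * (m - (y - l) - (x - i)).factorial =
      (m - (y - l)).factorial := Nat.choose_mul_factorial_mul_factorial (by omega)
  have e3 : m - (y - l) - (x - i) = i + l - 1 := by omega
  rw [e3] at e2
  have e4 : (x - i).factorial * x.descFactorial i = x.factorial := Nat.factorial_mul_descFactorial hi
  have e5 : (y - l).factorial * y.descFactorial l = y.factorial := Nat.factorial_mul_descFactorial hl
  have hk : (0:ℝ) < ((i + l - 1).factorial : ℕ) := by exact_mod_cast (i + l - 1).factorial_pos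
  have hxi : (0:ℝ) < ((x - i).factorial : ℕ) := by exact_mod_cast (x - i).factorial_pos
  have hyl : (0:ℝ) < ((y - l).factorial : ℕ) := by exact_mod_cast (y - l).factorial_pos
  rw [div_mul_div_comm, eq_div_iff (by positivity)]
  -- clear denominators and compare in ℕ
  have key : ((m.choose (y - l) * ((m - (y - l)).choose (x - i)) : ℕ) : ℝ) * ((x - i).factorial : ℕ) *
      ((y - l).factorial : ℕ) * ((i + l - 1).factorial : ℕ) = (m.factorial : ℝ) := by
    have : (m.choose (y - l) * ((m - (y - l)).choose (x - i))) * (x - i).factorial * (y - l).factorial *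
        (i + l - 1).factorial = m.factorial := by
      rw [← e1, ← e2]; ring
    exact_mod_cast this
  have key2 : (x.factorial : ℝ) * (y.factorial : ℝ) =
      ((x - i).factorial : ℕ) * ((y - l).factorial : ℕ) * ((x.descFactorial i * y.descFactorial l : ℕ) : ℝ) := by
    have : x.factorial * y.factorial = (x - i).factorial * (y - l).factorial * (x.descFactorial i * y.descFactorial l) := by
      rw [← e4, ← e5]; ring
    exact_mod_cast this
  rw [key2]
  have := key
  nlinarith [key, hk, hxi, hyl, mul_pos hxi hyl]

/-- **THEOREM MT in the lists-model normalisation of LEAN-ROADMAP-MT-g30 §0 / MULTITYPE-PROOF-g30 (1.1).**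
With `G(x,y) := Σ_{s : Fin T → {0,1,2}} w(s) · [i+l ≥ 1] (x)_i (y)_l / (i+l−1)!` (`i, l` = numbers of copies in states
`1 = X`, `2 = Y`; `Zc(x,y) = (x+y−1)!·G(x,y)`), for `0 ≤ p_τ ≤ 1`, `0 ≤ q_τ` and `a + c ≥ 1`:
`(a+c)·G(a+1,c)·G(a,c+1) ≤ (a+c+1)·G(a+1,c+1)·G(a,c)`. -/
theorem multiType_lsm_G (p q : Fin T → ℝ) (hp0 : ∀ τ, 0 ≤ p τ) (hp1 : ∀ τ, p τ ≤ 1) (hq : ∀ τ, 0 ≤ q τ)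
    (a c : ℕ) (hac : 1 ≤ a + c) :
    ((a + c : ℕ) : ℝ) *
      (∑ s : Fin T → Fin 3, (∏ τ, (if s τ = 1 then p τ else if s τ = 2 then q τ else 1)) *
        (if 1 ≤ (univ.filter (fun τ => s τ = 1)).card + (univ.filter (fun τ => s τ = 2)).card then
          (((a + 1).descFactorial (univ.filter (fun τ => s τ = 1)).card *
            c.descFactorial (univ.filter (fun τ => s τ = 2)).card : ℕ) : ℝ) /
            ((((univ.filter (fun τ => s τ = 1)).card + (univ.filter (fun τ => s τ = 2)).card - 1).factorial : ℕ) : ℝ)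
          else 0)) *
      (∑ s : Fin T → Fin 3, (∏ τ, (if s τ = 1 then p τ else if s τ = 2 then q τ else 1)) *
        (if 1 ≤ (univ.filter (fun τ => s τ = 1)).card + (univ.filter (fun τ => s τ = 2)).card then
          ((a.descFactorial (univ.filter (fun τ => s τ = 1)).card *
            (c + 1).descFactorial (univ.filter (fun τ => s τ = 2)).card : ℕ) : ℝ) /
            ((((univ.filter (fun τ => s τ = 1)).card + (univ.filter (fun τ => s τ = 2)).card - 1).factorial : ℕ) : ℝ)
          else 0)) ≤
    ((a + c + 1 : ℕ) : ℝ) *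
      (∑ s : Fin T → Fin 3, (∏ τ, (if s τ = 1 then p τ else if s τ = 2 then q τ else 1)) *
        (if 1 ≤ (univ.filter (fun τ => s τ = 1)).card + (univ.filter (fun τ => s τ = 2)).card then
          (((a + 1).descFactorial (univ.filter (fun τ => s τ = 1)).card *
            (c + 1).descFactorial (univ.filter (fun τ => s τ = 2)).card : ℕ) : ℝ) /
            ((((univ.filter (fun τ => s τ = 1)).card + (univ.filter (fun τ => s τ = 2)).card - 1).factorial : ℕ) : ℝ)
          else 0)) *
      (∑ s : Fin T → Fin 3, (∏ τ, (if s τ = 1 then p τ else if s τ = 2 then q τ else 1)) *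
        (if 1 ≤ (univ.filter (fun τ => s τ = 1)).card + (univ.filter (fun τ => s τ = 2)).card then
          ((a.descFactorial (univ.filter (fun τ => s τ = 1)).card *
            c.descFactorial (univ.filter (fun τ => s τ = 2)).card : ℕ) : ℝ) /
            ((((univ.filter (fun τ => s τ = 1)).card + (univ.filter (fun τ => s τ = 2)).card - 1).factorial : ℕ) : ℝ)
          else 0)) := by
  obtain ⟨n, hn⟩ : ∃ n, a + c = n + 1 := ⟨a + c - 1, by omega⟩
  have h := multiType_lsm_closedForm p q hp0 hp1 hq a c n
  -- convert each closed-form sum: F_m(x,y) = (m!/(x!y!)) · G(x,y)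
  have conv : ∀ (m x y : ℕ), m + 1 = x + y →
      ∑ s : Fin T → Fin 3, (∏ τ, (if s τ = 1 then p τ else if s τ = 2 then q τ else 1)) *
        (if (univ.filter (fun τ => s τ = 1)).card ≤ x ∧ (univ.filter (fun τ => s τ = 2)).card ≤ y then
          (((m.choose (y - (univ.filter (fun τ => s τ = 2)).card)) *
            ((m - (y - (univ.filter (fun τ => s τ = 2)).card)).choose
              (x - (univ.filter (fun τ => s τ = 1)).card)) : ℕ) : ℝ)
        else 0) =
      ((m.factorial : ℝ) / ((x.factorial : ℝ) * (y.factorial : ℝ))) *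
      ∑ s : Fin T → Fin 3, (∏ τ, (if s τ = 1 then p τ else if s τ = 2 then q τ else 1)) *
        (if 1 ≤ (univ.filter (fun τ => s τ = 1)).card + (univ.filter (fun τ => s τ = 2)).card then
          ((x.descFactorial (univ.filter (fun τ => s τ = 1)).card *
            y.descFactorial (univ.filter (fun τ => s τ = 2)).card : ℕ) : ℝ) /
            ((((univ.filter (fun τ => s τ = 1)).card + (univ.filter (fun τ => s τ = 2)).card - 1).factorial : ℕ) : ℝ)
          else 0) := by
    intro m x y hm
    rw [Finset.mul_sum]
    refine Finset.sum_congr rfl fun s _ => ?_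
    rw [choose_term_eq m x y _ _ hm]
    ring
  rw [conv (n + 1) (a + 1) c (by omega), conv (n + 1) a (c + 1) (by omega), conv (n + 2) (a + 1) (c + 1) (by omega),
    conv n a c (by omega)] at h
  -- compare the constants: (N+1)·αβ = N·γδ with N = n+1
  have hfa : ((a + 1).factorial : ℝ) = (a + 1 : ℕ) * (a.factorial : ℝ) := by exact_mod_cast Nat.factorial_succ a
  have hfc : ((c + 1).factorial : ℝ) = (c + 1 : ℕ) * (c.factorial : ℝ) := by exact_mod_cast Nat.factorial_succ c
  have hf1 : ((n + 1).factorial : ℝ) = (n + 1 : ℕ) * (n.factorial : ℝ) := by exact_mod_cast Nat.factorial_succ n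
  have hf2 : ((n + 2).factorial : ℝ) = (n + 2 : ℕ) * ((n + 1).factorial : ℝ) := by
    exact_mod_cast Nat.factorial_succ (n + 1)
  rw [hn, show n + 1 + 1 = n + 2 by ring]
  have hpos : ∀ k : ℕ, (0:ℝ) < k.factorial := fun k => by exact_mod_cast k.factorial_pos
  have ha := hpos a; have hc := hpos c; have hnf := hpos n
  -- abbreviate the four G sums
  set G1 := ∑ s : Fin T → Fin 3, (∏ τ, (if s τ = 1 then p τ else if s τ = 2 then q τ else 1)) *
        (if 1 ≤ (univ.filter (fun τ => s τ = 1)).card + (univ.filter (fun τ => s τ = 2)).card then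
          (((a + 1).descFactorial (univ.filter (fun τ => s τ = 1)).card *
            c.descFactorial (univ.filter (fun τ => s τ = 2)).card : ℕ) : ℝ) /
            ((((univ.filter (fun τ => s τ = 1)).card + (univ.filter (fun τ => s τ = 2)).card - 1).factorial : ℕ) : ℝ)
          else 0)
  set G2 := ∑ s : Fin T → Fin 3, (∏ τ, (if s τ = 1 then p τ else if s τ = 2 then q τ else 1)) *
        (if 1 ≤ (univ.filter (fun τ => s τ = 1)).card + (univ.filter (fun τ => s τ = 2)).card then
          ((a.descFactorial (univ.filter (fun τ => s τ = 1)).card *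
            (c + 1).descFactorial (univ.filter (fun τ => s τ = 2)).card : ℕ) : ℝ) /
            ((((univ.filter (fun τ => s τ = 1)).card + (univ.filter (fun τ => s τ = 2)).card - 1).factorial : ℕ) : ℝ)
          else 0)
  set G3 := ∑ s : Fin T → Fin 3, (∏ τ, (if s τ = 1 then p τ else if s τ = 2 then q τ else 1)) *
        (if 1 ≤ (univ.filter (fun τ => s τ = 1)).card + (univ.filter (fun τ => s τ = 2)).card then
          (((a + 1).descFactorial (univ.filter (fun τ => s τ = 1)).card *
            (c + 1).descFactorial (univ.filter (fun τ => s τ = 2)).card : ℕ) : ℝ) /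
            ((((univ.filter (fun τ => s τ = 1)).card + (univ.filter (fun τ => s τ = 2)).card - 1).factorial : ℕ) : ℝ)
          else 0)
  set G4 := ∑ s : Fin T → Fin 3, (∏ τ, (if s τ = 1 then p τ else if s τ = 2 then q τ else 1)) *
        (if 1 ≤ (univ.filter (fun τ => s τ = 1)).card + (univ.filter (fun τ => s τ = 2)).card then
          ((a.descFactorial (univ.filter (fun τ => s τ = 1)).card *
            c.descFactorial (univ.filter (fun τ => s τ = 2)).card : ℕ) : ℝ) /
            ((((univ.filter (fun τ => s τ = 1)).card + (univ.filter (fun τ => s τ = 2)).card - 1).factorial : ℕ) : ℝ)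
          else 0)
  clear_value G1 G2 G3 G4
  rw [hfa, hfc, hf2, hf1] at h
  -- h : (N! /((a+1)! c!)) G1 * ((N!/(a!(c+1)!)) G2) ≤ ((N+1)!/((a+1)!(c+1)!)) G3 * ((N-1)!/(a! c!)) G4 , N = n+1
  field_simp at h
  push_cast at h ⊢
  have hn1 : (0:ℝ) < ((n:ℝ) + 1) * (n.factorial : ℝ) := by positivity
  nlinarith [h, hn1, mul_pos hn1 ha]

end MultiTypeLSMClosedForm

end Summit.CriticalPhenomena.PercolationContinuityZ3.Theorems
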